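import Summits.CriticalPhenomena.PercolationContinuityZ3.Theorems.PercAnnulusCrossingBoxCrossingDefs
import Literature.Barriers.CriticalPhenomena.SpanningClustersAboveSixProofs
import Literature.Barriers.CriticalPhenomena.LaceExpansionEtaZeroXSpaceEventually
import HarnessLib

/-!
# RSW3 lane (lead, gen 13): the census cluster count `N(n,2n)` is NOT tight above six dimensions, while the
# two-arm bound holds there — the high-dimensional column of the BCKS postulates

builds on p205010 (kernel theorem, internal audit signed; external expert review pending) — NOT used in this file.

Cell `prim-rsw3` (LANE 3), lead seat, gen 13.  Support file (`--supports stmt-CriticalPhenomena-4575`); no definitions, no named facts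
of its own, no sorries.  The lane's census count `Crossing.annulusClusterCount d m n ω` (number of open clusters of the free box `Λ(n)`
meeting both `Λ(m)` and `∂ⁱⁿΛ(n)`; PREREG Q5; `Crossing.AnnulusClusterCountTight` is the Borgs–Chayes–Kesten–Spencer tightness postulate
for `N(n,2n)` on `ℤ³`) is compared with Aizenman's bulk spanning-cluster count `N_L` of the barrier catalogue
(`Literature.Barriers.CriticalPhenomena.numSpanningClusters`):

* `numSpanningClusters_le_annulusClusterCount_shift` — POINTWISE on lattice configurations: `N_n(ω) ≤ N(n,2n)(ω + n·e₁)`: each open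
  cluster of `ℤ^d` meeting both faces `{x₁ = ∓n}` of `Λ_n` contains, after the shift by `n e₁`, a vertex of `Λ(n)` joined inside `Λ(2n)` to
  `∂ⁱⁿΛ(2n)` (stop at the first visit), and distinct clusters give distinct clusters of the free box `Λ(2n)`;
* `real_le_numSpanningClusters_le` — hence `P_p(K ≤ N_n) ≤ P_p(K ≤ N(n,2n))` for every `p`, `d`, `K` (translation invariance);
* **`tendsto_real_le_annulusClusterCount_of_twoPointBoundedRatio`** — for `d > 6` under (t-c) with `η = 0`: `P_{p_c}(K ≤ N(n,2n)) → 1` for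
  every real `K` (Aizenman 1997 Thm. 4 (3), the catalogue's `SpanningClustersAboveSix_holds.numSpanning_ge_tendsto_one`): **the census count is
  NOT TIGHT above six dimensions** (`not_tight_annulusClusterCount_of_twoPointBoundedRatio`: the `d`-general form of `AnnulusClusterCountTight` fails);
* `two_le_annulusClusterCount_subset_compl_uniqZone` + **`tendsto_annulusTwoArmProb_of_twoPointBoundedRatio`** — `{2 ≤ N(m,n)} ⊆ (uniqZone m n)ᶜ`,
  so `α₂(n,2n) = annulusTwoArmProb d p_c n (2n) → 1`: the bounded-ratio TWO-ARM lower bound (the lane's `AnnulusTwoArmLowerBound`, `d = 3`,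
  PROVED there from `θ(p_c) = 0`) is dimension-ROBUST;
* UNCONDITIONAL forms for all sufficiently large `d` (`twoPointBoundedRatio_eventually`, no named fact):
  `exists_forall_tendsto_real_le_annulusClusterCount`, `exists_forall_tendsto_annulusTwoArmProb`.

With V149/V154 (`…SetToSetHighDim{,Aspect}`) and the barrier `SpanningClustersAboveSix` (X_B) this completes the dimension-sensitivity table of
the LANE-4 / BCKS inputs: (A2)□ ✗, X_B ✗, tightness ✗ (fail above six dimensions) versus two arms ✓, one-arm doubling ✓ (hold there); on `ℤ³` under
X_B the count is tight (lead gen 2) and `≥ 2`, `≥ 3` with probability bounded below (p2 gens 10/15).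

References: Aizenman, Nucl. Phys. B 485 (1997) Thm. 4 (3) and §5 [Aizenman1997]; Borgs–Chayes–Kesten–Spencer, Random Structures Algorithms 15
(1999) §1 [BorgsChayesKestenSpencer1999]; Heydenreich–van der Hofstad (2017) Thm. 11.4 [HeydenreichVanDerHofstad2017].
-/

noncomputable section

namespace Summit.CriticalPhenomena.PercolationContinuityZ3.Theorems.Crossing

open MeasureTheory Filter Topology
open Literature.Probability.Percolation Literature.Probability.LatticeModels
open Literature.Barriers.CriticalPhenomena
open scoped ENNReal

variable {d : ℕ}

/-! ## Bulk spanning clusters inject into crossing clusters of the free box -/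

/-- **`N_n(ω) ≤ N(n,2n)(ω + n e₁)` on lattice configurations.**  Every open cluster of `ℤ^d` meeting both faces `{x₁ = -n}`, `{x₁ = n}` of
`Λ_n` yields, in the configuration shifted by `n e₁`, a cluster of the free box `Λ(2n)` meeting `Λ(n)` and `∂ⁱⁿΛ(2n)` (first visit of the shifted
spanning path to `∂ⁱⁿΛ(2n)`), injectively. (adapted from the catalogue's `relabel_shift_mem_annulusCrossing`.) [cite: Aizenman1997, §5 (bulk b.c.)] -/
theorem numSpanningClusters_le_annulusClusterCount_shift [NeZero d] (n : ℕ) {ω : BondConfig (Site d)}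
    (hωE : ω ⊆ (zdGraph d).edgeSet) :
    numSpanningClusters d n ω ≤
      annulusClusterCount d n (2 * n) (BondConfig.relabel (sym2Equiv (Site.shift (Pi.single 0 (n : ℤ)))) ω) := by
  classical
  set v : Site d := Pi.single 0 (n : ℤ) with hv
  set ω' : BondConfig (Site d) := BondConfig.relabel (sym2Equiv (Site.shift v)) ω with hω'
  -- transport of open paths
  let φ : openGraph ω ≃g openGraph ω' :=
    { toEquiv := Site.shift v
      map_rel_iff' := fun {a b} => openGraph_relabel_adj_iff (Site.shift v) ω a b }
  -- `ω'` is a lattice configuration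
  have hω'sub : ω' ⊆ (zdGraph d).edgeSet := by
    intro z hz
    rw [hω', BondConfig.mem_relabel_iff] at hz
    have hzE : (sym2Equiv (Site.shift v)).symm z ∈ (zdGraph d).edgeSet := hωE hz
    let ψ : zdGraph d ≃g zdGraph d :=
      { toEquiv := Site.shift v
        map_rel_iff' := fun {a b} => zdGraph_adj_shift_iff v a b }
    have key := sym2Equiv_mem_edgeSet_iff ψ ((sym2Equiv (Site.shift v)).symm z)
    have hz' : sym2Equiv ψ.toEquiv ((sym2Equiv (Site.shift v)).symm z) = z :=
      (sym2Equiv (Site.shift v)).apply_symm_apply z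
    rw [hz'] at key
    exact key.2 hzE
  have hle : openGraph ω' ≤ zdGraph d := Literature.Barriers.CriticalPhenomena.openGraph_le_of_subset hω'sub
  -- the two counted sets
  set B : Finset (Site d) := box d (2 * n) with hB
  set G' := (openGraph ω').induce (↑B : Set (Site d)) with hG'
  set S := {C : (openGraph ω).ConnectedComponent |
      (∃ x ∈ leftFace d n, x ∈ C.supp) ∧ ∃ y ∈ rightFace d n, y ∈ C.supp} with hS
  set T := {C : G'.ConnectedComponent |
      (∃ x : ↥(↑B : Set (Site d)), (x : Site d) ∈ box d n ∧ x ∈ C.supp) ∧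
      ∃ y : ↥(↑B : Set (Site d)), (y : Site d) ∈ innerBoundary (zdGraph d) B ∧ y ∈ C.supp} with hT
  change S.encard ≤ T.encard
  -- representatives on the left face
  have hrep : ∀ C ∈ S, ∃ x ∈ leftFace d n, x ∈ C.supp := fun C hC => hC.1
  choose! xr hxrL hxrC using hrep
  have hxrB : ∀ C ∈ S, xr C + v ∈ (↑B : Set (Site d)) := fun C hC =>
    Finset.mem_coe.2 (box_subset_box_two_mul d n (add_single_mem_box_of_mem_leftFace (hxrL C hC)))
  -- the map
  have h0B : (0 : Site d) ∈ (↑B : Set (Site d)) := Finset.mem_coe.2 (zero_mem_box d _)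
  let g : (openGraph ω).ConnectedComponent → G'.ConnectedComponent := fun C =>
    if hC : C ∈ S then G'.connectedComponentMk ⟨xr C + v, hxrB C hC⟩ else G'.connectedComponentMk ⟨0, h0B⟩
  have hg : ∀ C (hC : C ∈ S), g C = G'.connectedComponentMk ⟨xr C + v, hxrB C hC⟩ := fun C hC => by
    simp only [g, hC, dite_true]
  -- `g` maps `S` into `T`
  have hgT : ∀ C ∈ S, g C ∈ T := by
    intro C hC
    obtain ⟨y, hyR, hyC⟩ := hC.2
    have hxC := hxrC C hC
    rw [SimpleGraph.ConnectedComponent.mem_supp_iff] at hxC hyC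
    have hreach : (openGraph ω).Reachable (xr C) y := SimpleGraph.ConnectedComponent.exact (hxC.trans hyC.symm)
    have hreach' : (openGraph ω').Reachable (xr C + v) (y + v) := hreach.map φ.toHom
    obtain ⟨w⟩ := hreach'
    have hyv : y + v ∈ innerBoundary (zdGraph d) B := add_single_mem_innerBoundary_of_mem_rightFace hyR
    obtain ⟨b, hb, hu, hb', hr⟩ := exists_innerBoundary_reachable_of_walk_end hle B w (hxrB C hC) (fun _ => hyv)
    rw [hg C hC]
    refine ⟨⟨⟨xr C + v, hxrB C hC⟩, add_single_mem_box_of_mem_leftFace (hxrL C hC), rfl⟩, ⟨⟨b, hb'⟩, hb, ?_⟩⟩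
    rw [SimpleGraph.ConnectedComponent.mem_supp_iff]
    exact SimpleGraph.ConnectedComponent.sound hr.symm
  -- `g` is injective on `S`
  have hginj : Set.InjOn g S := by
    intro C hC C' hC' hCC'
    rw [hg C hC, hg C' hC'] at hCC'
    have hr' : G'.Reachable ⟨xr C + v, hxrB C hC⟩ ⟨xr C' + v, hxrB C' hC'⟩ := SimpleGraph.ConnectedComponent.exact hCC'
    have hr'' : (openGraph ω').Reachable (xr C + v) (xr C' + v) := hr'.map (SimpleGraph.Embedding.induce _).toHom
    have hr : (openGraph ω).Reachable (xr C) (xr C') := by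
      have := hr''.map φ.symm.toHom
      simpa [φ] using this
    have hxC := hxrC C hC
    have hxC' := hxrC C' hC'
    rw [SimpleGraph.ConnectedComponent.mem_supp_iff] at hxC hxC'
    rw [← hxC, ← hxC']
    exact SimpleGraph.ConnectedComponent.sound hr
  calc S.encard = (g '' S).encard := (hginj.encard_image).symm
    _ ≤ T.encard := Set.encard_le_encard (Set.image_subset_iff.2 fun C hC => hgT C hC)

/-- **`P_p(K ≤ N_n) ≤ P_p(K ≤ N(n,2n))`** for every `p`, `d ≥ 1` and real `K` (the pointwise injection and the translation invariance of `P_p`).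
[cite: Aizenman1997, §5 (bulk b.c.)] -/
theorem real_le_numSpanningClusters_le [NeZero d] (p : unitInterval) (n : ℕ) (K : ℝ) :
    (bondPercolation (zdGraph d) p).real {ω | ENNReal.ofReal K ≤ (numSpanningClusters d n ω : ℝ≥0∞)} ≤
      (bondPercolation (zdGraph d) p).real {ω | ENNReal.ofReal K ≤ (annulusClusterCount d n (2 * n) ω : ℝ≥0∞)} := by
  rw [← bondPercolation_real_preimage_shift (Pi.single 0 (n : ℤ)) p
    {ω | ENNReal.ofReal K ≤ (annulusClusterCount d n (2 * n) ω : ℝ≥0∞)}]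
  refine DCT16.real_mono_of_forall_subset_edgeSet (zdGraph d) p fun ω hω hmem => ?_
  rw [Set.mem_preimage, Set.mem_setOf_eq]
  exact le_trans hmem (ENat.toENNReal_le.2 (numSpanningClusters_le_annulusClusterCount_shift n hω))

/-! ## No tightness above six dimensions -/

/-- **The census count is NOT tight above six dimensions.**  For `d > 6` with (t-c), `η = 0` (`TwoPointBoundedRatio d`): for every real `K`,
`P_{p_c}(K ≤ annulusClusterCount d n (2n)) → 1` as `n → ∞` (Aizenman 1997, Thm. 4 (3) for the bulk count, transferred). Contrast: in two
dimensions `P(N ≥ k) ≤ e^{-αk²}` (ibid. Thm. 3), and on `ℤ³` under X_B the count is tight (lead gen 2). [cite: Aizenman1997, Thm. 4 (3)] -/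
theorem tendsto_real_le_annulusClusterCount_of_twoPointBoundedRatio [NeZero d] (hd : 6 < d) (hτ : TwoPointBoundedRatio d) (K : ℝ) :
    Tendsto (fun n : ℕ => (bondPercolation (zdGraph d) (criticalProbI d)).real
        {ω | ENNReal.ofReal K ≤ (annulusClusterCount d n (2 * n) ω : ℝ≥0∞)}) atTop (𝓝 1) :=
  tendsto_of_tendsto_of_tendsto_of_le_of_le (SpanningClustersAboveSix_holds.numSpanning_ge_tendsto_one hd hτ K)
    tendsto_const_nhds (fun n => real_le_numSpanningClusters_le _ n K) fun _ => measureReal_le_one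

/-- **The `d`-general form of `AnnulusClusterCountTight` fails above six dimensions**: for `d > 6` with `TwoPointBoundedRatio d` there is NO
`K` with `P_{p_c}(K < annulusClusterCount d n (2n)) ≤ 1/2` for all `n ≥ 1` (so the tightness schema `∀ ε > 0 ∃ K ∀ n ≥ 1, P(K < N) ≤ ε` is false
at `(d, p_c)`). [cite: Aizenman1997, Thm. 4 (3)] [cite: BorgsChayesKestenSpencer1999, §1 (postulates)] -/
theorem not_tight_annulusClusterCount_of_twoPointBoundedRatio [NeZero d] (hd : 6 < d) (hτ : TwoPointBoundedRatio d) :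
    ¬ ∀ ε : ℝ, 0 < ε → ∃ K : ℕ, ∀ n : ℕ, 1 ≤ n →
      (bondPercolation (zdGraph d) (criticalProbI d)).real {ω | (K : ℕ∞) < annulusClusterCount d n (2 * n) ω} ≤ ε := by
  intro h
  obtain ⟨K, hK⟩ := h (1 / 2) (by norm_num)
  have ht := tendsto_real_le_annulusClusterCount_of_twoPointBoundedRatio hd hτ ((K : ℝ) + 1)
  have hev : ∀ᶠ n : ℕ in atTop, (bondPercolation (zdGraph d) (criticalProbI d)).real
      {ω | ENNReal.ofReal ((K : ℝ) + 1) ≤ (annulusClusterCount d n (2 * n) ω : ℝ≥0∞)} ≤ 1 / 2 := by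
    filter_upwards [Filter.eventually_ge_atTop 1] with n hn
    refine le_trans (measureReal_mono (fun ω hω => ?_)) (hK n hn)
    rw [Set.mem_setOf_eq] at hω ⊢
    have h1 : ENNReal.ofReal ((K : ℝ) + 1) = ((K + 1 : ℕ) : ℝ≥0∞) := by
      rw [show ((K : ℝ) + 1) = ((K + 1 : ℕ) : ℝ) by push_cast; ring, ENNReal.ofReal_natCast]
    rw [h1, show (((K + 1 : ℕ) : ℝ≥0∞)) = (((K + 1 : ℕ) : ℕ∞) : ℝ≥0∞) from rfl, ENat.toENNReal_le] at hω
    exact lt_of_lt_of_le (by exact_mod_cast Nat.lt_succ_self K) hω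
  have := le_of_tendsto ht hev
  linarith

/-! ## Two arms above six dimensions -/

/-- `{2 ≤ N(m,n)} ⊆ (uniqZone m n)ᶜ`: two distinct open clusters of `Λ(n)` each meeting `Λ(m)` and `∂ⁱⁿΛ(n)` give two vertices of `Λ(m)` joined
inside `Λ(n)` to `∂ⁱⁿΛ(n)` and not to each other (the converse inclusion is gen 4's `two_le_annulusClusterCount_of_not_mem_uniqZone`).
[cite: MartineauTassion2017, §3.1.2 (uniqueness zone)] -/
theorem not_mem_uniqZone_of_two_le_annulusClusterCount {m n : ℕ} {ω : BondConfig (Site d)}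
    (h : (2 : ℕ∞) ≤ annulusClusterCount d m n ω) : ω ∉ uniqZone (d := d) m n := by
  classical
  intro hU
  set B : Finset (Site d) := box d n with hB
  set G' := (openGraph ω).induce (↑B : Set (Site d)) with hG'
  set T := {C : G'.ConnectedComponent |
      (∃ x : ↥(↑B : Set (Site d)), (x : Site d) ∈ box d m ∧ x ∈ C.supp) ∧
      ∃ y : ↥(↑B : Set (Site d)), (y : Site d) ∈ innerBoundary (zdGraph d) B ∧ y ∈ C.supp} with hT
  change (2 : ℕ∞) ≤ T.encard at h
  -- two distinct counted components
  have h1 : (1 : ℕ∞) < T.encard := lt_of_lt_of_le (by exact_mod_cast (by norm_num : (1 : ℕ) < 2)) h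
  obtain ⟨C₁, C₂, hC₁, hC₂T, hC₁₂⟩ := Set.one_lt_encard_iff.1 h1
  -- representatives
  obtain ⟨⟨x₁, hx₁m, hx₁C⟩, ⟨y₁, hy₁b, hy₁C⟩⟩ := hC₁
  obtain ⟨⟨x₂, hx₂m, hx₂C⟩, ⟨y₂, hy₂b, hy₂C⟩⟩ := hC₂T
  rw [SimpleGraph.ConnectedComponent.mem_supp_iff] at hx₁C hy₁C hx₂C hy₂C
  have hb₁ : ω ∈ toBdry n (x₁ : Site d) :=
    ⟨y₁, hy₁b, x₁.2, y₁.2, SimpleGraph.ConnectedComponent.exact (hx₁C.trans hy₁C.symm)⟩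
  have hb₂ : ω ∈ toBdry n (x₂ : Site d) :=
    ⟨y₂, hy₂b, x₂.2, y₂.2, SimpleGraph.ConnectedComponent.exact (hx₂C.trans hy₂C.symm)⟩
  have h12 := hU x₁ hx₁m x₂ hx₂m hb₁ hb₂
  obtain ⟨hx₁B, hx₂B, hr⟩ := h12
  have : C₁ = C₂ := by
    rw [← hx₁C, ← hx₂C]
    exact SimpleGraph.ConnectedComponent.sound (by
      have e1 : (⟨(x₁ : Site d), hx₁B⟩ : ↥(↑B : Set (Site d))) = x₁ := Subtype.ext rfl
      have e2 : (⟨(x₂ : Site d), hx₂B⟩ : ↥(↑B : Set (Site d))) = x₂ := Subtype.ext rfl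
      rw [e1, e2] at hr
      exact hr)
  exact hC₁₂ this

/-- **The two-arm probability tends to ONE above six dimensions**: for `d > 6` with `TwoPointBoundedRatio d`,
`annulusTwoArmProb d p_c n (2n) = P_{p_c}((uniqZone n (2n))ᶜ) → 1`.  So the bounded-ratio two-arm LOWER bound of the lane (`AnnulusTwoArmLowerBound`
on `ℤ³`, proved from `θ(p_c) = 0`) is dimension-robust, unlike tightness, X_B and (A2)□. [cite: Aizenman1997, Thm. 4 (3)] -/
theorem tendsto_annulusTwoArmProb_of_twoPointBoundedRatio [NeZero d] (hd : 6 < d) (hτ : TwoPointBoundedRatio d) :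
    Tendsto (fun n : ℕ => annulusTwoArmProb d (criticalProbI d) n (2 * n)) atTop (𝓝 1) := by
  refine tendsto_of_tendsto_of_tendsto_of_le_of_le (tendsto_real_le_annulusClusterCount_of_twoPointBoundedRatio hd hτ 2)
    tendsto_const_nhds (fun n => measureReal_mono fun ω hω => ?_) fun _ => measureReal_le_one
  rw [Set.mem_setOf_eq] at hω
  have h2 : ENNReal.ofReal (2 : ℝ) = (((2 : ℕ) : ℕ∞) : ℝ≥0∞) := by
    rw [show (2 : ℝ) = ((2 : ℕ) : ℝ) by norm_num, ENNReal.ofReal_natCast]; rfl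
  rw [h2, ENat.toENNReal_le] at hω
  exact not_mem_uniqZone_of_two_le_annulusClusterCount (by exact_mod_cast hω)

/-! ## Unconditional forms for all sufficiently large `d` -/

/-- **No tightness of the census count in every sufficiently high dimension — UNCONDITIONAL** (the catalogue's hypothesis-free
`twoPointBoundedRatio_eventually`). [cite: Aizenman1997, Thm. 4 (3)] [cite: Hara2008, Thm. 1.1] -/
theorem exists_forall_tendsto_real_le_annulusClusterCount :
    ∃ d₀ : ℕ, ∀ d : ℕ, d₀ ≤ d → ∀ K : ℝ, ∀ [NeZero d],
      Tendsto (fun n : ℕ => (bondPercolation (zdGraph d) (criticalProbI d)).real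
        {ω | ENNReal.ofReal K ≤ (annulusClusterCount d n (2 * n) ω : ℝ≥0∞)}) atTop (𝓝 1) := by
  obtain ⟨d₀, h6, h⟩ := twoPointBoundedRatio_eventually
  exact ⟨d₀, fun d hd K _ => tendsto_real_le_annulusClusterCount_of_twoPointBoundedRatio (by omega) (h d hd) K⟩

/-- **Two arms with probability tending to one in every sufficiently high dimension — UNCONDITIONAL.**
[cite: Aizenman1997, Thm. 4 (3)] [cite: Hara2008, Thm. 1.1] -/
theorem exists_forall_tendsto_annulusTwoArmProb :
    ∃ d₀ : ℕ, ∀ d : ℕ, d₀ ≤ d → ∀ [NeZero d],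
      Tendsto (fun n : ℕ => annulusTwoArmProb d (criticalProbI d) n (2 * n)) atTop (𝓝 1) := by
  obtain ⟨d₀, h6, h⟩ := twoPointBoundedRatio_eventually
  exact ⟨d₀, fun d hd _ => tendsto_annulusTwoArmProb_of_twoPointBoundedRatio (by omega) (h d hd)⟩

end Summit.CriticalPhenomena.PercolationContinuityZ3.Theorems.Crossing
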